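import Mathlib.Data.Matrix.Mul
import Mathlib.Data.ZMod.Basic
import Mathlib.LinearAlgebra.Matrix.ToLin
import Mathlib.Algebra.BigOperators.Ring.Finset
import Mathlib.Data.Fintype.BigOperators
import Literature.Computability.AlgebraicComplexity.LaserHashing
import HarnessLib

/-!
# Affine hashing over `𝔽₂`: pairwise independence and the set-size bound (trunk CplxCore)

The hash family `h_{A,b}(x) = A x + b`, `A ∈ 𝔽₂^{k×m}`, `b ∈ 𝔽₂^k`, from `{0,1}^m` to `{0,1}^k`
(Arora–Barak 2009, Def. 8.14 and Exercise 8.4 — the matrix variant of the `GF(2ⁿ)` family of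
Thm. 8.15) is **pairwise independent**: for `x ≠ x'` the pair `(h(x), h(x'))` is uniform on
`{0,1}^k × {0,1}^k` (`card_filter_hash_pair`), and `h(x)` is uniform (`card_filter_hash_eq`). Both are
fibre counts of surjective additive maps (the tree's
`Literature.Computability.AlgebraicComplexity.card_filter_mul_card_eq_card_of_surjective`, `AlgebraicComplexity/LaserHashing.lean`:
the fibres of a surjective additive homomorphism between finite groups all have the same size).

Relation to `SipserCodingLemma.lean` (same trunk, `Literature.CplxCore.SipserHash`): that file hashes
`Fin M → Bool` by *linear* maps over `GF(2)` (`hashVal`, rows `dotZ`) and proves the collision bound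
`two_mul_card_filter_dotZ_eq` that Sipser's Coding Lemma needs; linear families are not pairwise
independent (every linear map sends `0 ↦ 0`), and Chebyshev-type arguments (Stockmeyer's
estimator, `StockmeyerEstimator.lean`) need full pairwise independence, which the affine shift `b`
provides — hence this second, affine, family, on `Fin m → ZMod 2` (Mathlib's `Matrix.mulVec`).
Consumers whose sets live in `List.Vector Bool m` (e.g. `Counting.countWitnesses`) transport along
the injection `y ↦ (i ↦ [y i])` into `Fin m → ZMod 2` (`Stockmeyer.toZ` in the consumer file); only
`x ≠ x'` is ever used of the set.

Consequence, the **set-size bound** behind the Goldwasser–Sipser protocol and Sipser–Stockmeyer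
approximate counting (Arora–Barak 2009, Claim 8.16.1, p. 187, via the degree-two inclusion–exclusion
bound, Cor. A.2): for `S ⊆ {0,1}^m` and any target `y`, the number `N` of hash functions `h` with
`∃ x ∈ S, h(x) = y` satisfies
`|S| · |ℋ| / 2^k ≥ N ≥ |S| · |ℋ| / 2^k − (|S| choose 2) · |ℋ| / 4^k`
(`card_exists_hash_le`, `card_exists_hash_ge`, stated multiplied out over `ℕ`), i.e.
`Pr_h[∃ x ∈ S, h(x) = y] ∈ [μ − μ²/2, μ]` for `μ = |S|/2^k`. The degree-two Bonferroni inequality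
for finite unions is `two_mul_card_biUnion_add_sum_ge`.

This is the probabilistic lemma of Stockmeyer's approximate counting theorem (the tree's named fact
`stockmeyerApproxCounting`, `ApproximateCounting.lean`, AA13 Thm. 4.1); the machine side (an `NP^O`
test "some `x ∈ S` hashes to `0^k`" and an `FP^{NP^O}` search over `k`) is not in this file.
All statements proved, Mathlib only.

## References

* S. Arora, B. Barak, *Computational Complexity: A Modern Approach*, CUP 2009, Def. 8.14, Thm. 8.15,
  Exercise 8.4 (pairwise independent hashing), Claim 8.16.1 (p. 187) with Cor. A.2.
* L. J. Stockmeyer, *On approximation algorithms for #P*, SIAM J. Comput. 14 (1985) 849–861, §3.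
* M. Sipser, *A complexity theoretic approach to randomness*, STOC 1983 (the coding lemma; see
  `SipserCodingLemma.lean`).
-/

namespace Literature.Computability.Complexity

open Finset Matrix

namespace AffineHash

variable (m k : ℕ)

/-- The hash functions `{0,1}^m → {0,1}^k`: pairs `(A, b)`, `A ∈ 𝔽₂^{k×m}`, `b ∈ 𝔽₂^k`.
[Arora–Barak 2009, Def. 8.14 with Exercise 8.4] [cite: AroraBarak2009, Def. 8.14] -/
abbrev Hash : Type := Matrix (Fin k) (Fin m) (ZMod 2) × (Fin k → ZMod 2)

variable {m k}

/-- `h_{A,b}(x) = A x + b`. [Arora–Barak 2009, Exercise 8.4] [cite: AroraBarak2009, Def. 8.14] -/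
def hash (h : Hash m k) (x : Fin m → ZMod 2) : Fin k → ZMod 2 := h.1.mulVec x + h.2

/-- Evaluation at one point, as an additive homomorphism of `(A, b)`. [folklore] -/
def evalHom (x : Fin m → ZMod 2) : Hash m k →+ (Fin k → ZMod 2) where
  toFun h := hash h x
  map_zero' := by simp [hash]
  map_add' h h' := by
    simp only [hash, Prod.fst_add, Prod.snd_add, Matrix.add_mulVec]
    abel

/-- Evaluation at two points, as an additive homomorphism of `(A, b)`. [folklore] -/
def evalPairHom (x x' : Fin m → ZMod 2) : Hash m k →+ (Fin k → ZMod 2) × (Fin k → ZMod 2) where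
  toFun h := (hash h x, hash h x')
  map_zero' := by simp [hash]
  map_add' h h' := by
    simp only [hash, Prod.fst_add, Prod.snd_add, Matrix.add_mulVec, Prod.mk_add_mk, Prod.mk.injEq]
    constructor <;> abel

/-- `evalHom x h = hash h x`. [folklore] -/
@[simp] theorem evalHom_apply (x : Fin m → ZMod 2) (h : Hash m k) : evalHom x h = hash h x := rfl

/-- `evalPairHom x x' h = (hash h x, hash h x')`. [folklore] -/
@[simp] theorem evalPairHom_apply (x x' : Fin m → ZMod 2) (h : Hash m k) :
    evalPairHom x x' h = (hash h x, hash h x') := rfl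

/-- Evaluation at one point is onto (`b := y − A x`). [folklore] -/
theorem evalHom_surjective (x : Fin m → ZMod 2) : Function.Surjective (evalHom (k := k) x) := by
  intro y
  refine ⟨(0, y), ?_⟩
  simp [hash]

/-- The matrix whose column `i₀` is `v` and whose other columns vanish. [folklore] -/
def colMatrix (i₀ : Fin m) (v : Fin k → ZMod 2) : Matrix (Fin k) (Fin m) (ZMod 2) :=
  Matrix.of fun r c => if c = i₀ then v r else 0

/-- `colMatrix i₀ v` sends `d` to `d i₀ • v`. [folklore] -/
theorem colMatrix_mulVec (i₀ : Fin m) (v : Fin k → ZMod 2) (d : Fin m → ZMod 2) :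
    (colMatrix i₀ v).mulVec d = d i₀ • v := by
  ext r
  simp only [Matrix.mulVec, dotProduct, colMatrix, Matrix.of_apply, Pi.smul_apply, smul_eq_mul]
  rw [Finset.sum_eq_single i₀ (fun c _ hc => by simp [hc]) (by simp)]
  simp [mul_comm]

/-- **Evaluation at two distinct points is onto** `{0,1}^k × {0,1}^k`: with `d = x' − x ≠ 0`, pick a
coordinate `i₀` with `d_{i₀} = 1`, let `A` have the single nonzero column `y' − y` at `i₀` (so
`A d = y' − y`) and `b = y − A x`. (Arora–Barak 2009, proof of Thm. 8.15: "the pair `⟨a, b⟩` is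
completely determined by these equations".) [cite: AroraBarak2009, Thm. 8.15 (proof)] -/
theorem evalPairHom_surjective {x x' : Fin m → ZMod 2} (hxx' : x ≠ x') :
    Function.Surjective (evalPairHom (k := k) x x') := by
  rintro ⟨y, y'⟩
  obtain ⟨i₀, hi₀⟩ : ∃ i₀, x' i₀ - x i₀ ≠ 0 := by
    by_contra h
    push Not at h
    exact hxx' (funext fun i => (sub_eq_zero.1 (h i)).symm)
  have hd : x' i₀ - x i₀ = 1 := by
    -- in `ZMod 2` a nonzero element is `1`
    have h2 : ∀ z : ZMod 2, z ≠ 0 → z = 1 := by decide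
    exact h2 _ hi₀
  set A := colMatrix i₀ (y' - y) with hA
  refine ⟨(A, y - A.mulVec x), ?_⟩
  simp only [evalPairHom_apply, hash, Prod.mk.injEq]
  constructor
  · abel
  · have hAd : A.mulVec (x' - x) = y' - y := by
      rw [hA, colMatrix_mulVec, Pi.sub_apply, hd, one_smul]
    rw [Matrix.mulVec_sub] at hAd
    have : A.mulVec x' = A.mulVec x + (y' - y) := by rw [← hAd]; abel
    rw [this]
    abel

/-- **One-point uniformity**: `#{h | h(x) = y} · 2^k = |ℋ|` (the evaluation map `h ↦ h(x)` is onto;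
for `m ≥ 1` also a consequence of pairwise independence, Arora–Barak 2009, Def. 8.14). [folklore] -/
theorem card_filter_hash_eq (x : Fin m → ZMod 2) (y : Fin k → ZMod 2) :
    (univ.filter fun h : Hash m k => hash h x = y).card * 2 ^ k = Fintype.card (Hash m k) := by
  have h := Literature.Computability.AlgebraicComplexity.card_filter_mul_card_eq_card_of_surjective (evalHom (k := k) x) (evalHom_surjective x) y
  simpa [Fintype.card_fun, ZMod.card] using h

/-- **Pairwise independence** of affine hashing: for `x ≠ x'` and all targets `y, y'`,
`#{h | h(x) = y ∧ h(x') = y'} · 4^k = |ℋ|`, i.e. `Pr_h[h(x) = y ∧ h(x') = y'] = 2^{-2k}`.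
[Arora–Barak 2009, Def. 8.14, Thm. 8.15 / Exercise 8.4] [cite: AroraBarak2009, Def. 8.14] -/
theorem card_filter_hash_pair {x x' : Fin m → ZMod 2} (hxx' : x ≠ x') (y y' : Fin k → ZMod 2) :
    (univ.filter fun h : Hash m k => hash h x = y ∧ hash h x' = y').card * (2 ^ k * 2 ^ k) =
      Fintype.card (Hash m k) := by
  have h := Literature.Computability.AlgebraicComplexity.card_filter_mul_card_eq_card_of_surjective (evalPairHom (k := k) x x')
    (evalPairHom_surjective hxx') (y, y')
  simpa [Fintype.card_fun, ZMod.card, Fintype.card_prod, Prod.ext_iff] using h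

/-! ### Degree-two inclusion–exclusion and the set-size bound -/

/-- **Bonferroni's inequality of degree two** (inclusion–exclusion truncated after the pair terms is a
lower bound), for finite unions, multiplied out:
`2 · |⋃_{x∈S} E_x| + Σ_{x ≠ x' ∈ S} |E_x ∩ E_{x'}| ≥ 2 · Σ_{x∈S} |E_x|` (ordered pairs).
[Arora–Barak 2009, Cor. A.2] [cite: AroraBarak2009, Cor. A.2] -/
theorem two_mul_card_biUnion_add_sum_ge {ι α : Type*} [DecidableEq ι] [DecidableEq α] (S : Finset ι) (E : ι → Finset α) :
    2 * ∑ x ∈ S, (E x).card ≤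
      2 * (S.biUnion E).card + ∑ x ∈ S, ∑ x' ∈ S.erase x, (E x ∩ E x').card := by
  induction S using Finset.induction_on with
  | empty => simp
  | insert a S ha ih =>
    rw [sum_insert ha, biUnion_insert, sum_insert ha, erase_insert ha]
    -- the pair sum over `insert a S`: the new pairs `(a, x)` and `(x, a)`, `x ∈ S`
    have hpairs : ∑ x ∈ S, ∑ x' ∈ (insert a S).erase x, (E x ∩ E x').card =
        ∑ x ∈ S, (E x ∩ E a).card + ∑ x ∈ S, ∑ x' ∈ S.erase x, (E x ∩ E x').card := by
      rw [← sum_add_distrib]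
      refine sum_congr rfl fun x hx => ?_
      have hax : a ≠ x := fun h => ha (h ▸ hx)
      rw [erase_insert_of_ne hax, sum_insert (fun h => ha (mem_of_mem_erase h))]
    rw [hpairs]
    -- `|E a ∪ U| + |E a ∩ U| = |E a| + |U|` and the union bound on `E a ∩ U = ⋃ (E a ∩ E x)`
    have hcup := card_union_add_card_inter (E a) (S.biUnion E)
    have hint : (E a ∩ S.biUnion E).card ≤ ∑ x ∈ S, (E x ∩ E a).card := by
      rw [inter_biUnion]
      refine card_biUnion_le.trans (sum_le_sum fun x _ => ?_)
      rw [inter_comm]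
    have hsym : ∑ x ∈ S, (E a ∩ E x).card = ∑ x ∈ S, (E x ∩ E a).card :=
      sum_congr rfl fun x _ => by rw [inter_comm]
    omega

/-- **The set-size bound, upper half**: `#{h | ∃ x ∈ S, h(x) = y} · 2^k ≤ |S| · |ℋ|` (union bound).
[Arora–Barak 2009, Claim 8.16.1 (p. 187)] [cite: AroraBarak2009, Claim 8.16.1 (p. 187)] -/
theorem card_exists_hash_le (S : Finset (Fin m → ZMod 2)) (y : Fin k → ZMod 2) :
    (univ.filter fun h : Hash m k => ∃ x ∈ S, hash h x = y).card * 2 ^ k ≤ S.card * Fintype.card (Hash m k) := by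
  have hU : (univ.filter fun h : Hash m k => ∃ x ∈ S, hash h x = y) =
      S.biUnion fun x => univ.filter fun h : Hash m k => hash h x = y := by
    ext h; simp
  rw [hU]
  calc (S.biUnion fun x => univ.filter fun h : Hash m k => hash h x = y).card * 2 ^ k
      ≤ (∑ x ∈ S, (univ.filter fun h : Hash m k => hash h x = y).card) * 2 ^ k :=
        Nat.mul_le_mul_right _ card_biUnion_le
    _ = S.card * Fintype.card (Hash m k) := by
        rw [sum_mul, sum_congr rfl fun x _ => card_filter_hash_eq x y, sum_const, smul_eq_mul]

/-- **The set-size bound, lower half** (Sipser–Stockmeyer / Goldwasser–Sipser): with `|ℋ|` the number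
of hash functions,
`2 · #{h | ∃ x ∈ S, h(x) = y} · 4^k + |S| (|S| − 1) · |ℋ| ≥ 2 |S| · 2^k · |ℋ|`,
i.e. `Pr_h[∃ x ∈ S, h(x) = y] ≥ μ − μ²/2 · (1 − 1/|S|) ≥ μ − μ²/2` for `μ = |S|/2^k` — by degree-two
inclusion–exclusion, one-point uniformity and pairwise independence. [Arora–Barak 2009, Claim 8.16.1
(p. 187) with Cor. A.2] [cite: AroraBarak2009, Claim 8.16.1 (p. 187)] -/
theorem card_exists_hash_ge (S : Finset (Fin m → ZMod 2)) (y : Fin k → ZMod 2) :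
    2 * S.card * 2 ^ k * Fintype.card (Hash m k) ≤
      2 * (univ.filter fun h : Hash m k => ∃ x ∈ S, hash h x = y).card * (2 ^ k * 2 ^ k) +
        S.card * (S.card - 1) * Fintype.card (Hash m k) := by
  set E : (Fin m → ZMod 2) → Finset (Hash m k) := fun x => univ.filter fun h => hash h x = y with hE
  have hU : (univ.filter fun h : Hash m k => ∃ x ∈ S, hash h x = y) = S.biUnion E := by
    ext h; simp [hE]
  have hB := two_mul_card_biUnion_add_sum_ge S E
  -- one-point uniformity: `|E x| · 2^k = |ℋ|`
  have h1 : ∀ x, (E x).card * 2 ^ k = Fintype.card (Hash m k) := fun x => card_filter_hash_eq x y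
  -- pairwise independence: `|E x ∩ E x'| · 4^k = |ℋ|` for `x ≠ x'`
  have h2 : ∀ x ∈ S, ∀ x' ∈ S.erase x, (E x ∩ E x').card * (2 ^ k * 2 ^ k) = Fintype.card (Hash m k) := by
    intro x _ x' hx'
    have hne : x ≠ x' := fun h => (Finset.mem_erase.1 hx').1 h.symm
    have := card_filter_hash_pair hne y y
    rw [← this]
    congr 2
    ext h; simp [hE]
  -- multiply the Bonferroni inequality by `4^k` and substitute
  have hmul := Nat.mul_le_mul_right (2 ^ k * 2 ^ k) hB
  rw [hU]
  have hsum1 : 2 * (∑ x ∈ S, (E x).card) * (2 ^ k * 2 ^ k) = 2 * S.card * 2 ^ k * Fintype.card (Hash m k) := by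
    rw [mul_assoc 2, sum_mul, show ∑ x ∈ S, (E x).card * (2 ^ k * 2 ^ k) = ∑ x ∈ S, 2 ^ k * Fintype.card (Hash m k)
      from sum_congr rfl fun x _ => by rw [← h1 x]; ring, sum_const, smul_eq_mul]
    ring
  have hsum2 : (∑ x ∈ S, ∑ x' ∈ S.erase x, (E x ∩ E x').card) * (2 ^ k * 2 ^ k) =
      S.card * (S.card - 1) * Fintype.card (Hash m k) := by
    rw [sum_mul, show ∑ x ∈ S, (∑ x' ∈ S.erase x, (E x ∩ E x').card) * (2 ^ k * 2 ^ k) =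
      ∑ x ∈ S, (S.card - 1) * Fintype.card (Hash m k) from sum_congr rfl fun x hx => by
        rw [sum_mul, sum_congr rfl fun x' hx' => h2 x hx x' hx', sum_const, smul_eq_mul, card_erase_of_mem hx],
      sum_const, smul_eq_mul]
    ring
  rw [add_mul, hsum2] at hmul
  rw [hsum1] at hmul
  exact hmul

end AffineHash

end Literature.Computability.Complexity
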